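import Literature.AlgebraicGeometry.Hyperkaehler.KugaSatakeCorrespondenceTransfer
import Literature.AlgebraicGeometry.Hyperkaehler.GeneralizedKummerTypeLefschetzStandard
import Literature.AlgebraicGeometry.Hyperkaehler.K3HilbertTypeLefschetzStandard
import HarnessLib

/-!
# Hodge similitudes of transcendental lattices of hyperkähler varieties are algebraic once the Kuga–Satake Hodge conjecture holds (Varesco, Math. Z. 305 (2023), Thm. 4.5, Cor. 4.6, Thm. 5.1) — NAMED FACTS

Layer `Literature/AlgebraicGeometry/Hyperkaehler`.  CITE record for the cross-ladder literature-typing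
layer (D-0088(4), tranche LT-H4, seat `hodge-lit-oqh-2`, generation 3; consumers: the Kuga–Satake road
of the summit `HodgeConjecture` and the TRANSFER lens of the ladder HodgeAV, rungs H2/H3).  The file
`KummerTypeHodgeSimilitudes` (same seat) records Floccari–Varesco's Theorem 3.3 — the `Kumⁿ` INSTANCE of
Varesco's theorem — and lists in its "Not here": "[Var23] Thm. 4.5 in its general form […] — the tree's
Kuga–Satake predicates are for surfaces only".  Since then `IsKSCorrespondenceAlgebraicHK` (file
`KugaSatakeCorrespondenceHyperkaehler`) and `transcendentalPart X b` (file `KummerTypeAssociatedK3Surface`)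
have landed, so the GENERAL engine is typable and is recorded here: for projective hyperkähler `X'`, `X`
of ANY deformation types and dimensions with algebraic Kuga–Satake correspondences, every Hodge similitude
of rational transcendental lattices `ψ : T(X') ⥲ T(X)` becomes algebraic after the Lefschetz twist
`h_X^{2n-2} ∪ ·` (Thm. 4.5), hence is algebraic once `X` satisfies Grothendieck's `B` (Cor. 4.6); and for
varieties of generalized Kummer type with Hodge-similar transcendental lattices EVERY Hodge morphism
`T(X') → T(X)` is algebraic (Thm. 5.1; Rem. 5.2: every Hodge endomorphism of `T(X)`).

HONEST FRAMING: typed ≠ proved ≠ endorsed.  Nothing in this file asserts the Hodge conjecture, the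
Kuga–Satake Hodge conjecture, `B(X)`, or any case of them; the three records are IMPLICATIONS printed
and proved in a refereed journal, whose antecedents are the tree's open predicates.

## Source (read at source; locators = files of the materialised arXiv text `paper:arxiv-2304.02519`)

* [Var23] M. Varesco, *Hodge similarities, algebraic classes, and Kuga–Satake varieties*, Math. Z.
  305 (2023), no. 4, art. 69, doi 10.1007/s00209-023-03390-8 (arXiv:2304.02519) [`Varesco2023`;
  REFEREED].  Conventions [corpus:paper-arxiv-2304.02519 p0007:L3–L5]: "In this paper, all varieties
  are assumed to be projective. […] A hyperkähler manifold is a simply connected, projective, compact,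
  Kähler manifold `X` such that `H⁰(X, Ω²_X)` is generated by a nowhere degenerate symplectic form"
  (= the tree's `IsProjectiveIrreducibleSymplectic (2 * n) X`); "`H²(X,ℚ) = NS(X)_ℚ ⊕ T(X)` […] When
  talking about the transcendental lattice […] we will always refer to the rational quadratic subspace
  `T(X)` of `H²(X,ℚ)`"; **Def. 1.2** [p0007:L43–L54]: a Hodge similarity is a Hodge isomorphism
  `ψ : V → V'` with `q_{V'}(ψv, ψw) = λ q_V(v,w)` for a non-zero `λ ∈ ℚ` (the multiplier); "two
  hyperkähler manifolds are Hodge similar […] if there exists a Hodge similarity […] between their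
  transcendental lattices".  **Conj. 4.2** (Kuga–Satake Hodge conjecture) [p0015:L16–L18]: "Let `X` be a
  hyperkähler manifold, then, the Kuga–Satake correspondence `κ_X` is algebraic" (`κ_X : H²(X,ℚ) ↪
  H¹(KS(X),ℚ)^{⊗2}`; Rem. 4.1 [p0015:L5–L8]: `KS(H²(X,ℚ))` "is an abelian variety isogenous to a power of
  `KS(T(X))`"; Rem. 4.3 [p0015:L20–L22]: independent of the choices `v₀, f₁, f₂`).
  **Theorem 4.5** [p0015:L79–p0016:L8], verbatim: "Let `X'` and `X` be two hyperkähler manifolds for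
  which the Kuga–Satake Hodge conjecture holds. Then, for every Hodge similarity `ψ : T(X') → T(X)`, the
  composition `T(X') →^ψ T(X) →^{h_X^{2n-2} ∪ ·} H^{4n-2}(X,ℚ)` is algebraic, where `2n := dim X`" (and
  Intro Thm. 3 [p0004:L28–L35]: "`h_X` is the cohomology class of an ample divisor on `X`"); proof
  [p0016:L10–L60]: Kuga–Satake functoriality under similitudes (**Prop. 3.1** [p0012:L7–L14], the isogeny
  `ψ_KS : KS(X') → KS(X)`), Lemma 4.4 (`φ = δ_X ∘ κ_X^∨ ∘ (h_KS^{2N-2} ∪ ·) ∘ κ_X|_{T(X)}` is a non-zero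
  rational multiple of `Id_{T(X)}`), "there exists a cycle `Γ ∈ CH^*(X' × X)` inducing the morphism
  `[Γ]_* = (h_X^{2n-2} ∪ ·) ∘ φ ∘ ψ : T(X') → H^{4n-2}(X,ℚ)`".  [p0016:L62–L65]: "The Lefschetz standard
  conjecture in degree two for `X` predicts that the inverse of `h_X^{2n-2} ∪ · : H²(X,ℚ) → H^{4n-2}(X,ℚ)`
  is algebraic. If `X` satisfies this conjecture, Theorem 4.5 gives the following:" **Corollary 4.6**
  [p0016:L67–L69], verbatim: "Let `X` and `X'` be hyperkähler manifolds satisfying the Kuga–Satake Hodge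
  conjecture. Assume moreover that `X` satisfies the Lefschetz standard conjecture in degree two. Then,
  every Hodge similarity `ψ : T(X') → T(X)` is algebraic."  §5 [p0017:L7–L8]: "hyperkähler manifolds of
  generalized Kummer type. For these varieties the Kuga–Satake Hodge conjecture is proven in [Voisin 2022]
  and the Lefschetz standard conjecture in degree two has been proven in [Foster]. […] we conclude that
  every Hodge similarity between the transcendental lattices of two hyperkähler manifolds of generalized
  Kummer type is algebraic. […] the dimension of the transcendental lattice of a hyperkähler manifold of
  generalized Kummer type is at most six-dimensional. Therefore, its endomorphism field is either a CM
  field or a totally real field of degree one or two. In all cases […] it is always generated by Hodge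
  similarities."  **Theorem 5.1** [p0017:L10–L12], verbatim: "Let `X` and `X'` be hyperkähler manifolds
  of generalized Kummer type such that `T(X)` and `T(X')` are Hodge similar. Then, every Hodge morphism
  between `T(X')` and `T(X)` is algebraic."  **Remark 5.2** [p0017:L14–L16]: "Taking `X = X'` […] every
  Hodge morphism in `E := End_Hdg(T(X))` is algebraic", and [p0017:L17–L35]: Thm. 5.1 also covers `X`,
  `X'` of generalized Kummer type of DIFFERENT dimensions.  **Theorem 5.3** [p0017:L41–L43] (K3
  surfaces), **Theorem 5.4** [p0017:L49–L53] (`K3^[n]`- and `K3^[n']`-type, by [Charles–Markman]),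
  **Remark 5.5** [p0018:L3–L5]: "This also works when `X` and `X'` are not of the same deformation type,
  and when the dimensions of `X` and `X'` are not the same."
* [FV24] S. Floccari, M. Varesco, Math. Ann. (2024) [`FloccariVaresco2024`], Thm. 3.3 — the `Kumⁿ`
  instance for similitudes of the FULL `H²`: `Varesco2023_hodgeSimilitude_algebraic_kummerType` (by name).
* [Flo26] S. Floccari, Geom. Topol. 30 (2026) [`Floccari2026`], §3.3 Rem. 3.4 (the `H²_tr`-form of the
  Kuga–Satake statement is equivalent to the `H²_prim`- and `H²`-forms) — the form of the tree's predicate.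

## Rendering (tree carriers) and faithfulness

* "hyperkähler manifold `X` of dimension `2n`" ([Var23] §1: projective, simply connected, `H⁰(Ω²)`
  spanned by a symplectic form): `hX : IsProjectiveIrreducibleSymplectic (2 * n) X` (file `OGradySixType`),
  `n ≥ 1`.  In Thm. 5.1 ("of generalized Kummer type") the tree's standing convention of
  `KummerTypeHodgeSimilitudes` / `GeneralizedKummerTypeHodgeConjecture` is kept: `Motives.IsSmoothProjective
  (2 * n) X ∧ IsOfGeneralizedKummerType n X`, `n ≥ 2` (irreducible symplectic is a consequence, Beauville).
* "the Kuga–Satake Hodge conjecture holds for `X`": `IsKSCorrespondenceAlgebraicHK n hX.1` (file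
  `KugaSatakeCorrespondenceHyperkaehler`) — the `H²_tr`-form of Floccari 2024 §5.1; [Var23] Conj. 4.2 is
  the `H²`-form, `KS(H²(X,ℚ))` being isogenous to a power of `KS(T(X))` (Rem. 4.1), and the forms are
  equivalent ([Flo26] Rem. 3.4; the predicate's own docstring).  Neither STRONGER nor WEAKER in print
  terms.
* "`T(X)`" relative to the Beauville–Bogomolov form: `transcendentalPart X b = NS(X)^{⊥_b} ⊗ ℂ` for a
  Fujiki form `b` (`IsFujikiForm n X b`: the Beauville–Bogomolov form up to `ℂˣ`; orthogonality does not
  see the scalar) — the carrier of `Floccari2026_kugaSatakeCorrespondence_algebraic_transfer`, clause for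
  clause, so that the records chain.
* "Hodge similarity `ψ : T(X') → T(X)`" (a `ℚ`-linear Hodge ISOMORPHISM of the rational transcendental
  lattices scaling the forms by `λ ∈ ℚˣ`): a `ℂ`-linear `ψ : H²(X'(ℂ); ℂ) → H²(X(ℂ); ℂ)` (its values
  off `T(X') ⊗ ℂ` are never used) which (1) maps RATIONAL classes of `T(X') ⊗ ℂ` to rational classes,
  (2) is BIJECTIVE from `T(X') ⊗ ℂ` onto `T(X) ⊗ ℂ` (`Set.BijOn`), (3) maps classes of `T(X') ⊗ ℂ` of
  Hodge type `(i,j)` to classes of type `(i,j)` (with (2), a Hodge isomorphism of the transcendental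
  Hodge structures: both sides split into their `(i,j)`-parts and an injective type-preserving map
  between spaces of equal dimension is bijective type by type), and (4) is ISOMETRIC on `T(X') ⊗ ℂ` for
  the pair of Fujiki forms `b'`, `b` — i.e. `q_X(ψx, ψy) = λ q_{X'}(x,y)` for the non-zero multiplier
  `λ` absorbed in the free scalars of `b'`, `b` (automatically rational on rational classes; its VALUE and
  SIGN are not recorded — print: `λ > 0` automatically).  Conversely such a `ψ` restricts on `T(X')_ℚ`
  (which spans `T(X') ⊗ ℂ`) to a Hodge similarity in print's sense, so each record is implied by print.
  This is the rendering of `Floccari2026_kugaSatakeCorrespondence_algebraic_transfer` plus the Hodge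
  clause (3) (there automatic, the map being cycle-induced), with rationality asked on `T(X')` only.
* "`h_X` the class of an ample divisor", "`h_X^{2n-2} ∪ ·`": a polarisation class `η` of `X`
  (`HodgeTheory.IsPolarizationClass (2 * n) X η`: rational, supported on a divisor, hard Lefschetz — the
  tree's standing rendering of `c₁` of an ample sheaf, files `MotivatedClasses`, `HardLefschetzNFold`) and
  the iterated Lefschetz operator `Literature.Geometry.Kaehler.lefschetzPow η (2 * n - 2) 2 :
  H²(X(ℂ); ℂ) → H^{2 + 2(2n-2)}(X(ℂ); ℂ) = H^{4n-2}`.  Because `IsPolarizationClass` is a priori WIDER than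
  "ample class" (e.g. `-[H]` qualifies) and the printed proof (Lemma 4.4) deforms the POLARISED pair
  `(X, h_X)`, Thm. 4.5 is recorded with `η` bound EXISTENTIALLY ("for SOME polarisation class `η` of `X`
  the twisted map is algebraic") — implied by print (an ample class is a polarisation class: integral,
  supported on the divisor, hard Lefschetz) and WEAKER than print's "for the class of every ample
  divisor"; never stronger.  For the algebraicity of `ψ` itself (Cor. 4.6) the choice of `η` is
  immaterial.
* "is algebraic" for a map defined on `T(X')` only ("there exists a cycle `Γ ∈ CH^*(X' × X)` inducing the
  morphism `[Γ]_* = … : T(X') → H^{4n-2}(X,ℚ)`"): there is a `ℂ`-linear `T` on all of `H²(X'(ℂ); ℂ)`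
  induced by an algebraic cycle on `X × X'` (`HodgeTheory.IsAlgebraicCorrespondence (2 * n) (2 * n') X X' T`
  — `ℂ`-span of cycle classes, the layer's convention; a rational cycle is in particular such) which AGREES
  with the given map on `transcendentalPart X' b'`.
* "X satisfies the Lefschetz standard conjecture in degree two" (Cor. 4.6: the inverse of
  `h_X^{2n-2} ∪ · : H² → H^{4n-2}` is algebraic): rendered by the tree's `B(X)` predicate in André's
  `*_L`-form for EVERY class, `∀ η, HodgeTheory.StandardConjectureBStar (2 * n) X η` (vacuous at
  non-polarisation classes; at a polarisation class: `*_L` algebraic in ALL degrees, in particular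
  `*_L : H^{4n-2} → H²`, which IS the inverse of `L_η^{2n-2}`) — a STRONGER hypothesis than print's
  degree-two statement for one ample class, so the record is WEAKER than print; it is the spelling in
  which the tree holds Foster's theorem for `Kumⁿ` (`Foster2024_lefschetzStandard_kummerType_prime`,
  `n + 1` prime) and Charles–Markman's for `K3^[n]` (`CharlesMarkman2013_lefschetzStandard_K3HilbertType`),
  the two feeders [Var23] §5 names.  (Cor. 4.6 = Thm. 4.5 composed with that inverse; composition of
  algebraic correspondences on the real carriers is proved only summit-side, `IsAlgebraicCorrespondence.comp`
  of `Ring2.AbelianAll`, not importable here — hence Cor. 4.6 is recorded as its own printed statement.)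
* "Hodge morphism `T(X') → T(X)`" (Thm. 5.1): a `ℂ`-linear `f : H²(X'(ℂ); ℂ) → H²(X(ℂ); ℂ)` mapping
  rational classes of `T(X') ⊗ ℂ` to rational classes, `T(X') ⊗ ℂ` into `T(X) ⊗ ℂ` (`Set.MapsTo`), and
  `(i,j)`-classes of `T(X') ⊗ ℂ` to `(i,j)`-classes; "`T(X)` and `T(X')` are Hodge similar": there EXISTS
  a `ψ` with (1)–(4) above.

Junk analysis.  `n ≥ 1` (`n ≥ 2` in Thm. 5.1) as printed; `2 * n - 2` is then an honest natural number.
All records quantify universally over Fujiki forms (vacuous only if none exists in the tree's semantics,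
safe side) and conclude with an `∃ T` whose agreement clause is on `transcendentalPart X' b'` only.

## Content and D-0026 accounting

Named facts (+3; each a refereed published theorem absent from the tree — `lean search` for
`Varesco2023|similitude|Similar|transcendentalPart|IsKSCorrespondenceAlgebraicHK` found only the `Kumⁿ`
full-`H²` record `Varesco2023_hodgeSimilitude_algebraic_kummerType`, the transfer record and the
definitions; none of the three is a restatement of those: Thm. 4.5/Cor. 4.6 have NO deformation-type
hypothesis, Thm. 5.1 is about all Hodge MORPHISMS):
`Varesco2023_lefschetzTwisted_transcendentalHodgeSimilitude_algebraic` (Thm. 4.5),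
`Varesco2023_transcendentalHodgeSimilitude_algebraic_of_lefschetzStandard` (Cor. 4.6),
`Varesco2023_transcendentalHodgeMorphism_algebraic_kummerType` (Thm. 5.1).  Kernel consequences (proved,
modulo the records and the tree's feeder records): Rem. 5.2 (`….hodgeEndomorphism`: every Hodge
endomorphism of `T(X)`, `X` of `Kumⁿ`-type, is algebraic — the transcendental part of the Hodge statement
for `X × X` in degree `4`; `….similitude`); §5 ¶1 for a
`Kumⁿ`-type target with `n + 1` prime (`….of_kummerType_target`, with
`Voisin2022_kugaSatakeCorrespondence_algebraic_kummerType` and `Foster2024_lefschetzStandard_kummerType_prime`;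
print has every `n` through Foster's degree-two theorem, which the tree does not hold); Thm. 5.4 by name
(`….of_k3HilbertType_target`, with `CharlesMarkman2013_lefschetzStandard_K3HilbertType`; the Kuga–Satake
antecedent for `K3^[n]`-type "has not been proven", [Var23] §5).

## Not here

Thm. 5.3 in the SURFACE vocabulary (`Surfaces.IsK3Surface`, `HodgeTheory.IsKSCorrespondenceAlgebraicBetti`,
`Surfaces.transcendentalSubspace`) — the `n = 1` case of Cor. 4.6 is covered here in the hyperkähler
vocabulary only (a projective K3 surface is `IsProjectiveIrreducibleSymplectic 2`, classically; no tree
lemma); [Var23] §2 (K3 surfaces with a symplectic automorphism, Thms. 2.x) and §3.1 (de Rham–Betti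
similarities are motivated); the multiplier values; any proof.
-/

noncomputable section

open CategoryTheory _root_.AlgebraicGeometry
open Literature.AlgebraicTopology.SingularHomology
open Literature.Geometry.Kaehler (lefschetzPow)

namespace Literature.AlgebraicGeometry.Hyperkaehler

open HodgeTheory

/-! ### The named facts -/

/-- **Varesco 2023, Theorem 4.5 — after the Lefschetz twist `h_X^{2n-2} ∪ ·`, every Hodge similitude of
rational transcendental lattices `T(X') ⥲ T(X)` between projective hyperkähler varieties whose Kuga–Satake
correspondences are algebraic is induced by an algebraic cycle on `X' × X` — for `X'`, `X` of ANY
deformation types and ANY dimensions.**  Print (verbatim in the module docstring): for `X'`, `X`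
hyperkähler manifolds for which the Kuga–Satake correspondence is algebraic and every Hodge similarity
`ψ : T(X') → T(X)`, "the composition `T(X') →^ψ T(X) →^{h_X^{2n-2} ∪ ·} H^{4n-2}(X,ℚ)` is algebraic, where
`2n := dim X`" (`h_X` the class of an ample divisor).  Rendering: for `n₁, n₂ ≥ 1`, `X₁`, `X₂` projective
irreducible symplectic of dimensions `2n₁`, `2n₂` with `IsKSCorrespondenceAlgebraicHK`, Fujiki forms `b₁`,
`b₂`, and `ψ : H²(X₁(ℂ); ℂ) → H²(X₂(ℂ); ℂ)` rational on, bijective from, type-preserving on and isometric on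
`transcendentalPart X₁ b₁` onto `transcendentalPart X₂ b₂`, there are a polarisation class `η` of `X₂`
(EXISTENTIAL — weaker than print's "every ample class", never stronger) and a `T : H²(X₁(ℂ); ℂ) →
H^{4n₂-2}(X₂(ℂ); ℂ)` induced by an algebraic cycle on `X₂ × X₁` with `T x = L_η^{2n₂-2}(ψ x)` for all
`x ∈ transcendentalPart X₁ b₁`.  A THEOREM in print (REFEREED: Math. Z. 2023; unproved in the tree).
[cite: Varesco2023, Thm. 4.5 (§4) with Def. 1.2, Conj. 4.2 and Rem. 4.1/4.3]
[cite: Floccari2026, §3.3 Rem. 3.4 (equivalence of the H²_tr- and H²-forms of the Kuga–Satake statement)] -/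
def Varesco2023_lefschetzTwisted_transcendentalHodgeSimilitude_algebraic : Prop :=
  -- antecedents: the tree's open Kuga–Satake predicate for `X₁` and for `X₂`; nothing is asserted
  ∀ (n₁ n₂ : ℕ), 1 ≤ n₁ → 1 ≤ n₂ →
  ∀ ⦃X₁ X₂ : Motives.SchemeOver ℂ⦄ (hX₁ : IsProjectiveIrreducibleSymplectic (2 * n₁) X₁)
    (hX₂ : IsProjectiveIrreducibleSymplectic (2 * n₂) X₂),
    IsKSCorrespondenceAlgebraicHK n₁ hX₁.1 → IsKSCorrespondenceAlgebraicHK n₂ hX₂.1 →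
  ∀ (b₁ : complexBetti X₁ 2 →ₗ[ℂ] complexBetti X₁ 2 →ₗ[ℂ] ℂ)
    (b₂ : complexBetti X₂ 2 →ₗ[ℂ] complexBetti X₂ 2 →ₗ[ℂ] ℂ),
    IsFujikiForm n₁ X₁ b₁ → IsFujikiForm n₂ X₂ b₂ →
  ∀ (ψ : complexBetti X₁ 2 →ₗ[ℂ] complexBetti X₂ 2),
    (∀ x ∈ transcendentalPart X₁ b₁, IsRationalClass x → IsRationalClass (ψ x)) →
    Set.BijOn ψ (transcendentalPart X₁ b₁) (transcendentalPart X₂ b₂) →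
    (∀ (i j : ℕ), ∀ x ∈ transcendentalPart X₁ b₁,
      IsOfHodgeType (2 * n₁) X₁ 2 i j x → IsOfHodgeType (2 * n₂) X₂ 2 i j (ψ x)) →
    (∀ x ∈ transcendentalPart X₁ b₁, ∀ y ∈ transcendentalPart X₁ b₁, b₂ (ψ x) (ψ y) = b₁ x y) →
  ∃ (η : complexBetti X₂ 2) (T : complexBetti X₁ 2 →ₗ[ℂ] complexBetti X₂ (2 + 2 * (2 * n₂ - 2))),
    IsPolarizationClass (2 * n₂) X₂ η ∧ IsAlgebraicCorrespondence (2 * n₂) (2 * n₁) X₂ X₁ T ∧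
      ∀ x ∈ transcendentalPart X₁ b₁, T x = lefschetzPow η (2 * n₂ - 2) 2 (ψ x)

/-- **Varesco 2023, Corollary 4.6 — every Hodge similitude of rational transcendental lattices
`T(X') ⥲ T(X)` between projective hyperkähler varieties whose Kuga–Satake correspondences are algebraic,
the target `X` satisfying Grothendieck's `B(X)` (Lefschetz type), is induced by an algebraic cycle on
`X' × X` — ANY deformation types, ANY dimensions** (Rem. 5.5: "This also works when `X` and `X'` are not
of the same deformation type, and when the dimensions of `X` and `X'` are not the same").  Print
(verbatim in the module docstring): under those two hypotheses on `X`, `X'` and `B` for `X` in degree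
two, "every Hodge similarity `ψ : T(X') → T(X)` is algebraic."  Rendering: binders of
`Varesco2023_lefschetzTwisted_transcendentalHodgeSimilitude_algebraic`, plus `B(X₂)` in the tree's
`*_L`-form (André; the predicate of file `MotivatedClasses`) for every class `η` — STRONGER than print's
degree-two hypothesis, so the record is WEAKER than print; it is the head symbol of the tree's Foster and
Charles–Markman records; conclusion: some `T : H²(X₁(ℂ); ℂ) → H²(X₂(ℂ); ℂ)` induced by an algebraic
cycle on `X₂ × X₁` agrees with `ψ` on `transcendentalPart X₁ b₁`.  Print: Thm. 4.5 composed with the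
algebraic inverse of `h_X^{2n-2} ∪ ·`.  A THEOREM in print (REFEREED: Math. Z. 2023; unproved in the
tree). [cite: Varesco2023, Cor. 4.6 (§4) and Rem. 5.5 (§5)]
[cite: Andre1996Motifs, Prop. 1.2 (p. 11) (B(X) ⟺ *_L algebraic)] -/
def Varesco2023_transcendentalHodgeSimilitude_algebraic_of_lefschetzStandard : Prop :=
  -- antecedents: the tree's open Kuga–Satake predicate (`X₁`, `X₂`) and `B(X₂)`; nothing is asserted
  ∀ (n₁ n₂ : ℕ), 1 ≤ n₁ → 1 ≤ n₂ →
  ∀ ⦃X₁ X₂ : Motives.SchemeOver ℂ⦄ (hX₁ : IsProjectiveIrreducibleSymplectic (2 * n₁) X₁)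
    (hX₂ : IsProjectiveIrreducibleSymplectic (2 * n₂) X₂),
    IsKSCorrespondenceAlgebraicHK n₁ hX₁.1 → IsKSCorrespondenceAlgebraicHK n₂ hX₂.1 →
    (∀ η : complexBetti X₂ 2, StandardConjectureBStar (2 * n₂) X₂ η) →
  ∀ (b₁ : complexBetti X₁ 2 →ₗ[ℂ] complexBetti X₁ 2 →ₗ[ℂ] ℂ)
    (b₂ : complexBetti X₂ 2 →ₗ[ℂ] complexBetti X₂ 2 →ₗ[ℂ] ℂ),
    IsFujikiForm n₁ X₁ b₁ → IsFujikiForm n₂ X₂ b₂ →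
  ∀ (ψ : complexBetti X₁ 2 →ₗ[ℂ] complexBetti X₂ 2),
    (∀ x ∈ transcendentalPart X₁ b₁, IsRationalClass x → IsRationalClass (ψ x)) →
    Set.BijOn ψ (transcendentalPart X₁ b₁) (transcendentalPart X₂ b₂) →
    (∀ (i j : ℕ), ∀ x ∈ transcendentalPart X₁ b₁,
      IsOfHodgeType (2 * n₁) X₁ 2 i j x → IsOfHodgeType (2 * n₂) X₂ 2 i j (ψ x)) →
    (∀ x ∈ transcendentalPart X₁ b₁, ∀ y ∈ transcendentalPart X₁ b₁, b₂ (ψ x) (ψ y) = b₁ x y) →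
  ∃ T : complexBetti X₁ 2 →ₗ[ℂ] complexBetti X₂ 2,
    IsAlgebraicCorrespondence (2 * n₂) (2 * n₁) X₂ X₁ T ∧ ∀ x ∈ transcendentalPart X₁ b₁, T x = ψ x

/-- **Varesco 2023, Theorem 5.1 — for varieties of generalized Kummer type with Hodge-similar
transcendental lattices, EVERY Hodge morphism `T(X') → T(X)` is induced by an algebraic cycle** (also for
`X`, `X'` of different dimensions, Rem. 5.2).  Verbatim: "Let `X` and `X'` be hyperkähler manifolds of
generalized Kummer type such that `T(X)` and `T(X')` are Hodge similar. Then, every Hodge morphism between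
`T(X')` and `T(X)` is algebraic."  Printed proof: Cor. 4.6 with [Voisin 2022] (Kuga–Satake) and [Foster]
(Lefschetz in degree two), and "the dimension of the transcendental lattice of a hyperkähler manifold of
generalized Kummer type is at most six […] its endomorphism field is either a CM field or a totally real
field of degree one or two […] always generated by Hodge similarities".  Rendering (module docstring): for
`n₁, n₂ ≥ 2`, `Xᵢ` smooth projective of dimension `2nᵢ` of `Kum^{nᵢ}`-type (the convention of
`Varesco2023_hodgeSimilitude_algebraic_kummerType`), Fujiki forms `b₁`, `b₂`, SOME `ψ` rational on,
bijective from, type-preserving on and isometric on `transcendentalPart X₁ b₁` onto `transcendentalPart X₂ b₂`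
(Hodge similar), and EVERY `f : H²(X₁(ℂ); ℂ) → H²(X₂(ℂ); ℂ)` rational on `transcendentalPart X₁ b₁`,
mapping it into `transcendentalPart X₂ b₂` and type-preserving on it (a Hodge morphism `T(X₁) → T(X₂)`),
some `T` induced by an algebraic cycle on `X₂ × X₁` agrees with `f` on `transcendentalPart X₁ b₁`.  A
THEOREM in print (REFEREED: Math. Z. 2023; unproved in the tree). [cite: Varesco2023, Thm. 5.1 and Rem. 5.2 (§5)]
[cite: FloccariVaresco2024, Thm. 3.3 (§3) (the similitude instance on the full H²)] -/
def Varesco2023_transcendentalHodgeMorphism_algebraic_kummerType : Prop :=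
  ∀ (n₁ n₂ : ℕ), 2 ≤ n₁ → 2 ≤ n₂ →
  ∀ ⦃X₁ X₂ : Motives.SchemeOver ℂ⦄, Motives.IsSmoothProjective (2 * n₁) X₁ →
    Motives.IsSmoothProjective (2 * n₂) X₂ →
    IsOfGeneralizedKummerType n₁ X₁ → IsOfGeneralizedKummerType n₂ X₂ →
  ∀ (b₁ : complexBetti X₁ 2 →ₗ[ℂ] complexBetti X₁ 2 →ₗ[ℂ] ℂ)
    (b₂ : complexBetti X₂ 2 →ₗ[ℂ] complexBetti X₂ 2 →ₗ[ℂ] ℂ),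
    IsFujikiForm n₁ X₁ b₁ → IsFujikiForm n₂ X₂ b₂ →
  (∃ ψ : complexBetti X₁ 2 →ₗ[ℂ] complexBetti X₂ 2,
    (∀ x ∈ transcendentalPart X₁ b₁, IsRationalClass x → IsRationalClass (ψ x)) ∧
    Set.BijOn ψ (transcendentalPart X₁ b₁) (transcendentalPart X₂ b₂) ∧
    (∀ (i j : ℕ), ∀ x ∈ transcendentalPart X₁ b₁,
      IsOfHodgeType (2 * n₁) X₁ 2 i j x → IsOfHodgeType (2 * n₂) X₂ 2 i j (ψ x)) ∧
    (∀ x ∈ transcendentalPart X₁ b₁, ∀ y ∈ transcendentalPart X₁ b₁, b₂ (ψ x) (ψ y) = b₁ x y)) →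
  ∀ (f : complexBetti X₁ 2 →ₗ[ℂ] complexBetti X₂ 2),
    (∀ x ∈ transcendentalPart X₁ b₁, IsRationalClass x → IsRationalClass (f x)) →
    Set.MapsTo f (transcendentalPart X₁ b₁) (transcendentalPart X₂ b₂) →
    (∀ (i j : ℕ), ∀ x ∈ transcendentalPart X₁ b₁,
      IsOfHodgeType (2 * n₁) X₁ 2 i j x → IsOfHodgeType (2 * n₂) X₂ 2 i j (f x)) →
  ∃ T : complexBetti X₁ 2 →ₗ[ℂ] complexBetti X₂ 2,
    IsAlgebraicCorrespondence (2 * n₂) (2 * n₁) X₂ X₁ T ∧ ∀ x ∈ transcendentalPart X₁ b₁, T x = f x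

/-! ### Kernel consequences -/

namespace Varesco2023_transcendentalHodgeMorphism_algebraic_kummerType

/-- **Varesco 2023, Remark 5.2 — every Hodge endomorphism of the transcendental lattice of a projective
variety of `Kumⁿ`-type is induced by an algebraic cycle on `X × X`** ("Taking `X = X'` […] every Hodge
morphism in `E := End_Hdg(T(X))` is algebraic"): the identity is a Hodge similitude `T(X) ⥲ T(X)`, so
Thm. 5.1 applies with `X₁ = X₂ = X`, `b₁ = b₂ = b`.  This is the transcendental part of the Hodge
statement for `X × X` in degree `4` (the Hodge classes of `T(X) ⊗ T(X) ⊂ H⁴(X × X, ℚ)` are the Hodge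
endomorphisms of `T(X)`).  Kernel, modulo the record. [cite: Varesco2023, Rem. 5.2 (§5)] -/
theorem hodgeEndomorphism (h : Varesco2023_transcendentalHodgeMorphism_algebraic_kummerType)
    {n : ℕ} (hn : 2 ≤ n) {X : Motives.SchemeOver ℂ} (hX : Motives.IsSmoothProjective (2 * n) X)
    (hKum : IsOfGeneralizedKummerType n X) {b : complexBetti X 2 →ₗ[ℂ] complexBetti X 2 →ₗ[ℂ] ℂ}
    (hb : IsFujikiForm n X b) {f : complexBetti X 2 →ₗ[ℂ] complexBetti X 2}
    (hfrat : ∀ x ∈ transcendentalPart X b, IsRationalClass x → IsRationalClass (f x))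
    (hfT : Set.MapsTo f (transcendentalPart X b) (transcendentalPart X b))
    (hfH : ∀ (i j : ℕ), ∀ x ∈ transcendentalPart X b,
      IsOfHodgeType (2 * n) X 2 i j x → IsOfHodgeType (2 * n) X 2 i j (f x)) :
    ∃ T : complexBetti X 2 →ₗ[ℂ] complexBetti X 2,
      IsAlgebraicCorrespondence (2 * n) (2 * n) X X T ∧ ∀ x ∈ transcendentalPart X b, T x = f x :=
  h n n hn hn hX hX hKum hKum b b hb hb
    ⟨LinearMap.id, fun _ _ hx ↦ hx, Set.bijOn_id _, fun _ _ _ _ hx ↦ hx, fun _ _ _ _ ↦ rfl⟩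
    f hfrat hfT hfH

/-- A Hodge similitude is in particular a Hodge morphism: under the hypotheses of Thm. 5.1 the
similitude `ψ` itself is induced by an algebraic cycle (the transcendental-lattice form of [FV24]
Thm. 3.3, whose full-`H²` form is `Varesco2023_hodgeSimilitude_algebraic_kummerType`).
[cite: Varesco2023, Thm. 5.1 (§5)] [cite: FloccariVaresco2024, Thm. 3.3 (§3)] -/
theorem similitude (h : Varesco2023_transcendentalHodgeMorphism_algebraic_kummerType)
    {n₁ n₂ : ℕ} (hn₁ : 2 ≤ n₁) (hn₂ : 2 ≤ n₂) {X₁ X₂ : Motives.SchemeOver ℂ}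
    (hX₁ : Motives.IsSmoothProjective (2 * n₁) X₁) (hX₂ : Motives.IsSmoothProjective (2 * n₂) X₂)
    (hK₁ : IsOfGeneralizedKummerType n₁ X₁) (hK₂ : IsOfGeneralizedKummerType n₂ X₂)
    {b₁ : complexBetti X₁ 2 →ₗ[ℂ] complexBetti X₁ 2 →ₗ[ℂ] ℂ}
    {b₂ : complexBetti X₂ 2 →ₗ[ℂ] complexBetti X₂ 2 →ₗ[ℂ] ℂ}
    (hb₁ : IsFujikiForm n₁ X₁ b₁) (hb₂ : IsFujikiForm n₂ X₂ b₂)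
    {ψ : complexBetti X₁ 2 →ₗ[ℂ] complexBetti X₂ 2}
    (hψrat : ∀ x ∈ transcendentalPart X₁ b₁, IsRationalClass x → IsRationalClass (ψ x))
    (hψbij : Set.BijOn ψ (transcendentalPart X₁ b₁) (transcendentalPart X₂ b₂))
    (hψH : ∀ (i j : ℕ), ∀ x ∈ transcendentalPart X₁ b₁,
      IsOfHodgeType (2 * n₁) X₁ 2 i j x → IsOfHodgeType (2 * n₂) X₂ 2 i j (ψ x))
    (hψiso : ∀ x ∈ transcendentalPart X₁ b₁, ∀ y ∈ transcendentalPart X₁ b₁, b₂ (ψ x) (ψ y) = b₁ x y) :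
    ∃ T : complexBetti X₁ 2 →ₗ[ℂ] complexBetti X₂ 2,
      IsAlgebraicCorrespondence (2 * n₂) (2 * n₁) X₂ X₁ T ∧ ∀ x ∈ transcendentalPart X₁ b₁, T x = ψ x :=
  h n₁ n₂ hn₁ hn₂ hX₁ hX₂ hK₁ hK₂ b₁ b₂ hb₁ hb₂ ⟨ψ, hψrat, hψbij, hψH, hψiso⟩ ψ hψrat hψbij.mapsTo hψH

end Varesco2023_transcendentalHodgeMorphism_algebraic_kummerType

namespace Varesco2023_transcendentalHodgeSimilitude_algebraic_of_lefschetzStandard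

/-- **[Var23] §5 ¶1 for a target of `Kumⁿ`-type with `n + 1` prime (kernel, with Voisin 2022 and
Foster 2024):** a Hodge similitude `T(X₁) ⥲ T(X₂)` from ANY projective irreducible symplectic `X₁`
satisfying the Kuga–Satake statement to a projective irreducible symplectic `X₂` of `Kumⁿ`-type, `n + 1`
prime, is induced by an algebraic cycle — "For these varieties the Kuga–Satake Hodge conjecture is proven
in [Voisin 2022] and the Lefschetz standard conjecture in degree two has been proven in [Foster]".  Print
has every `n` (Foster's degree-two theorem for composite `n + 1` is not in the tree, see
`GeneralizedKummerTypeLefschetzStandard`).  Kernel, modulo the three records. [cite: Varesco2023, §5 (first paragraph) and Cor. 4.6]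
[cite: Voisin2022FootnotesOGradyMarkman, Thm. 1.5 = Thm. 4.1] [cite: Foster2024, Cor. 2 (§1.1)] -/
theorem of_kummerType_target (h : Varesco2023_transcendentalHodgeSimilitude_algebraic_of_lefschetzStandard)
    (hV : Voisin2022_kugaSatakeCorrespondence_algebraic_kummerType)
    (hF : Foster2024_lefschetzStandard_kummerType_prime)
    {n₁ n : ℕ} (hn₁ : 1 ≤ n₁) (hn : 2 ≤ n) (hp : (n + 1).Prime) {X₁ X : Motives.SchemeOver ℂ}
    (hX₁ : IsProjectiveIrreducibleSymplectic (2 * n₁) X₁) (hX : IsProjectiveIrreducibleSymplectic (2 * n) X)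
    (hKS₁ : IsKSCorrespondenceAlgebraicHK n₁ hX₁.1) (hKum : IsOfGeneralizedKummerType n X)
    {b₁ : complexBetti X₁ 2 →ₗ[ℂ] complexBetti X₁ 2 →ₗ[ℂ] ℂ}
    {b : complexBetti X 2 →ₗ[ℂ] complexBetti X 2 →ₗ[ℂ] ℂ}
    (hb₁ : IsFujikiForm n₁ X₁ b₁) (hb : IsFujikiForm n X b)
    {ψ : complexBetti X₁ 2 →ₗ[ℂ] complexBetti X 2}
    (hψrat : ∀ x ∈ transcendentalPart X₁ b₁, IsRationalClass x → IsRationalClass (ψ x))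
    (hψbij : Set.BijOn ψ (transcendentalPart X₁ b₁) (transcendentalPart X b))
    (hψH : ∀ (i j : ℕ), ∀ x ∈ transcendentalPart X₁ b₁,
      IsOfHodgeType (2 * n₁) X₁ 2 i j x → IsOfHodgeType (2 * n) X 2 i j (ψ x))
    (hψiso : ∀ x ∈ transcendentalPart X₁ b₁, ∀ y ∈ transcendentalPart X₁ b₁, b (ψ x) (ψ y) = b₁ x y) :
    ∃ T : complexBetti X₁ 2 →ₗ[ℂ] complexBetti X 2,
      IsAlgebraicCorrespondence (2 * n) (2 * n₁) X X₁ T ∧ ∀ x ∈ transcendentalPart X₁ b₁, T x = ψ x :=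
  h n₁ n hn₁ (by omega) hX₁ hX hKS₁ (hV n hn hX.1 hKum) (fun η ↦ hF n hp hX.1 hKum η)
    b₁ b hb₁ hb ψ hψrat hψbij hψH hψiso

/-- **Varesco 2023, Theorem 5.4, by name (kernel, with Charles–Markman):** "Let `X` and `X'` be
hyperkähler manifolds of `K3^[n]`- and `K3^[n']`-type for which the Kuga–Satake Hodge conjecture holds.
Then, every Hodge similarity between `T(X')` and `T(X)` is algebraic" — here for a target `X₂` of
`K3^[n]`-type and ANY projective irreducible symplectic source `X₁`, both satisfying the Kuga–Satake
statement ("The Kuga–Satake Hodge conjecture has not been proven for hyperkähler manifolds of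
`K3^[n]`-type", [Var23] §5: the antecedent is open in print).  Kernel, modulo the two records.
[cite: Varesco2023, Thm. 5.4 (§5) and Cor. 4.6] [cite: CharlesMarkman2013, Thm. 1.1 (§1)] -/
theorem of_k3HilbertType_target (h : Varesco2023_transcendentalHodgeSimilitude_algebraic_of_lefschetzStandard)
    (hCM : CharlesMarkman2013_lefschetzStandard_K3HilbertType)
    {n₁ n₂ : ℕ} (hn₁ : 1 ≤ n₁) (hn₂ : 1 ≤ n₂) {X₁ X₂ : Motives.SchemeOver ℂ}
    (hX₁ : IsProjectiveIrreducibleSymplectic (2 * n₁) X₁) (hX₂ : IsProjectiveIrreducibleSymplectic (2 * n₂) X₂)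
    (hKS₁ : IsKSCorrespondenceAlgebraicHK n₁ hX₁.1) (hKS₂ : IsKSCorrespondenceAlgebraicHK n₂ hX₂.1)
    (hK3 : IsOfK3HilbertType n₂ X₂)
    {b₁ : complexBetti X₁ 2 →ₗ[ℂ] complexBetti X₁ 2 →ₗ[ℂ] ℂ}
    {b₂ : complexBetti X₂ 2 →ₗ[ℂ] complexBetti X₂ 2 →ₗ[ℂ] ℂ}
    (hb₁ : IsFujikiForm n₁ X₁ b₁) (hb₂ : IsFujikiForm n₂ X₂ b₂)
    {ψ : complexBetti X₁ 2 →ₗ[ℂ] complexBetti X₂ 2}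
    (hψrat : ∀ x ∈ transcendentalPart X₁ b₁, IsRationalClass x → IsRationalClass (ψ x))
    (hψbij : Set.BijOn ψ (transcendentalPart X₁ b₁) (transcendentalPart X₂ b₂))
    (hψH : ∀ (i j : ℕ), ∀ x ∈ transcendentalPart X₁ b₁,
      IsOfHodgeType (2 * n₁) X₁ 2 i j x → IsOfHodgeType (2 * n₂) X₂ 2 i j (ψ x))
    (hψiso : ∀ x ∈ transcendentalPart X₁ b₁, ∀ y ∈ transcendentalPart X₁ b₁, b₂ (ψ x) (ψ y) = b₁ x y) :
    ∃ T : complexBetti X₁ 2 →ₗ[ℂ] complexBetti X₂ 2,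
      IsAlgebraicCorrespondence (2 * n₂) (2 * n₁) X₂ X₁ T ∧ ∀ x ∈ transcendentalPart X₁ b₁, T x = ψ x :=
  h n₁ n₂ hn₁ hn₂ hX₁ hX₂ hKS₁ hKS₂ (fun η ↦ hCM n₂ hX₂.1 hK3 η) b₁ b₂ hb₁ hb₂ ψ hψrat hψbij hψH hψiso

end Varesco2023_transcendentalHodgeSimilitude_algebraic_of_lefschetzStandard

end Literature.AlgebraicGeometry.Hyperkaehler

end
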